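import Summits.BirchSwinnertonDyer.BirchSwinnertonDyer.Theorems.SchneiderFreeAdditiveX3ControlLeMinimal
import Summits.BirchSwinnertonDyer.Rank1Residual.Additive.QuadraticTwistBSDComparisonIsogeny
import HarnessLib

/-!
# Route `SchneiderFreeAdditiveX3` (K1 door): the rung leaf's INDEX-TRIVIAL REGIME — at a pair carrying a Heegner
# datum whose index `[E(K):ℤP]` lies within the Tamagawa + Manin slack, the leaf `AdditiveX3RankOneLower` holds
# from `PrintedFacts` ALONE: no main conjecture, no control, no Poitou–Tate, no Kriz–Li, no preprint

Cell `bsd-schneider-ideate`, seat `bsd-schneider-door-c5` (prover, generation 38; `--supports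
stmt-BirchSwinnertonDyer-19177 --as helper`, leaf-side support). PARTITION: board row B6 ∩ X3 ∩ sst-twist, `r = 1`
(7 101 census pairs) of `Rank1Residual.partition` — types-the-object-of nothing new; closes none of B6's cells; BSD is
NOT advanced; «closes rung: none».  bears_on: K1-door (the rung leaf `SchneiderFree.AdditiveX3RankOneLower`'s BODY
at a pair, WITHOUT the branch cruxes r2 `PotMultBranchIMC` (19176) / r3 `GordTwoBranchIMC` (19177)).

## The observation

The route closes the leaf from STEP L (`SchneiderFree.AdditiveStepLInputManinAt`: at EVERY Heegner/parametrisation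
datum `(N, K, Dt, H, ι, P)` of the pair, `IndexLowerBoundLeAt W p K P (v_p Dt.c)`, i.e.
`2·ord_p[E(K):ℤP] ≤ ord_p #Ш(E/K) + 2·ord_p ∏_ℓ c_ℓ(E) + 2·v_p(c)`) and the two CLOSED items `JointLowerManin`
(19180, Gross–Zagier bookkeeping) and `PartnerUpperRankZero` (19181, the rank-zero twist's upper half), the latter two
PROVED in the tree on `PrintedFacts`.  STEP L is where the research content sits: it is derived from the lower
Iwasawa main conjecture on the branch (r2 / r3: Keller–Yin's preprint divisibility [DIV.dvd], the analytic sentences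
[AN3] / [AN-BR₅], the sliver) plus anticyclotomic control.  But the leaf's proof consumes STEP L AT ONE DATUM only,
and AT A DATUM the inequality is TRIVIALLY TRUE as soon as

  `ord_p [E(K):ℤP] ≤ ord_p ∏_ℓ c_ℓ(E) + v_p(c)`                                                    (IDX)

(drop the non-negative term `ord_p #Ш(E/K)`).  Door-c2 generation 2 isolated the corresponding «unit-index regime» AT
THE SOCKET (`…PotMultBranchIMCReceptacle.additiveIMCLowerBDPOnTreeLeAt_of_control_of_index_unit`, which still needs
the control EQUALITY at the frame); at the LEAF nothing at all is needed: (IDX) ⟹ STEP L at the datum ⟹ the leaf's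
body `MissingLowerBoundAt W p` by the closed items.  Since `[E(K):ℤP] = I_K · #E(K)_tors` up to a power of `2` for the
Heegner index `I_K = [E(K)/tors : ℤP]`, and `I_K/c` is what the Gross–Zagier formula computes (Gross–Zagier I.(6.3) in
Miller's normalisation, LMS JCM 14 (2011) Thm. 4.1), (IDX) is a PER-PAIR ARITHMETIC CERTIFICATE decidable from
`L′(E,1)`, `L(E^{d_K},1)`, the real period, the regulator of a generator and the Tamagawa numbers — exactly the
currency of the b2b lane's Heegner-index certificates, but WITHOUT Kolyvagin's bound (which is unavailable at an
Eisenstein prime): census of this generation, kit job «idxcert» (HOME memos/census-door-c5-g38/).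

## What is proved (CONDITIONAL on the displayed named facts `PrintedFacts` = thirteen published theorems, item 19184)

* §1 `indexLowerBoundLeAt_of_padicValNat_index_le` — (IDX) ⟹ STEP L at the datum (`omega`);
  `missingLowerBoundAt_of_printedFacts_of_indexLowerBoundLeAt` — **the leaf's body at `(W, p)` from `PrintedFacts` and
  STEP L AT ONE door datum** (the route's class-level chain `…ControlLeMinimal.additiveX3RankOneLower_of_printedFacts_…`
  read at a single datum: twist model, `JointLowerManin`, `PartnerUpperRankZero`);
  **`missingLowerBoundAt_of_printedFacts_of_indexLe`** — the leaf's body from `PrintedFacts` and a door datum with (IDX).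
* §2 `missingLowerBoundAt_of_printedFacts_of_indexLe_of_isIsogenous` — the same for EVERY globally minimal `W′ ∼ W`
  (Cassels' isogeny invariance, b2b's `TwistComparison.missingLowerBoundAt_of_isIsogenous`): one certificate per
  ISOGENY CLASS.
* §3 `additiveX3RankOneLower_onIndexLocus_of_printedFacts` — the locus form over all pairs of the door.

HONEST FRAMING.  Nothing here is asserted about any curve; the EXISTENCE of a datum with (IDX) at a given pair is a
computation (evidence, kit), not a theorem, and it FAILS exactly where the leaf has content (heuristically, by BSD
itself, where `p ∣ #Ш(E)·#Ш(E^{d_K})` for every admissible `K`); the cruxes r2/r3 and the class-level leaf are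
untouched; no item closes; BSD is proved for no curve.
References: Gross–Zagier, Invent. Math. 84 (1986) I.(6.3) [GrossZagier1986]; Jetchev–Skinner–Wan 2017 §7.4.1
(eq:shalowerK-1) [JetchevSkinnerWan2017]; Miller, LMS JCM 14 (2011) Def. 1.1, Thm. 4.1 [Miller2011LMS]; Cassels 1965
/ Milne ADT I.7.3 [MilneADT2006]; this route p447721/p448348 (door-c4, leaf chain), p421158 (door-c2 g2, socket regime).
-/

set_option autoImplicit false
-- `Summit.<P>.<Sub>` repeats `BirchSwinnertonDyer` by the tree's layout convention (D-0017)
set_option linter.dupNamespace false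

noncomputable section

open scoped Classical

open Field NumberField IsDedekindDomain WeierstrassCurve
open Literature.NumberTheory.EllipticCurves Literature.NumberTheory.EllipticCurves.ModularForms
  Literature.NumberTheory.EllipticCurves.Rank1Residual Literature.NumberTheory.EllipticCurves.Rank1Residual.Typed
  Summit.BirchSwinnertonDyer.Rank1Residual Summit.BirchSwinnertonDyer.Rank1Residual.X11b
  Summit.BirchSwinnertonDyer.BirchSwinnertonDyer.Theorems.SchneiderFree
  Summit.BirchSwinnertonDyer.BirchSwinnertonDyer.Theses.SchneiderFreeAdditiveX3

namespace Summit.BirchSwinnertonDyer.BirchSwinnertonDyer.Theorems.SchneiderFreeAdditiveX3.LeafIndexRegime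

/-! ### §1 The leaf's body at a pair from `PrintedFacts` and ONE datum with the index inequality -/

section PerDatum

variable {W : WeierstrassCurve ℚ} [W.IsElliptic] [W.IsGloballyMinimal] {p : ℕ} [Fact p.Prime]
  {K : Type} [Field K] [NumberField K]

omit [W.IsElliptic] [W.IsGloballyMinimal] [Fact p.Prime] in
/-- **(IDX) ⟹ STEP L at the datum.** If `ord_p [E(K):ℤP] ≤ ord_p ∏_ℓ c_ℓ(E) + s` then
`IndexLowerBoundLeAt W p K P s` (`2·ord_p[E(K):ℤP] ≤ ord_p #Ш(E/K) + 2·ord_p ∏ c_ℓ + 2s`): the `Ш`-term is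
non-negative. [cite: JetchevSkinnerWan2017, §7.4.1 (eq:shalowerK-1) (arXiv:1512.06894 p. 30)] -/
theorem indexLowerBoundLeAt_of_padicValNat_index_le (P : (W.baseChange K).toAffine.Point) {s : ℕ}
    (hidx : padicValNat p (AddSubgroup.zmultiples P).index ≤ padicValNat p W.tamagawaProduct + s) :
    IndexLowerBoundLeAt W p K P s := by
  unfold IndexLowerBoundLeAt
  omega

end PerDatum

/-- **The leaf's body at a pair of the door from `PrintedFacts` and STEP L AT ONE DATUM.**  For `W/ℚ` globally
minimal on the door at an odd prime `p` (`r_an = 1`, `ClassX3 W p`, semistable twist), a Heegner datum of the door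
`(N = N_W, K, Dt, H, ι, P)` (`K` imaginary quadratic, `d_K` odd, `p ∤ #𝓞_K^×`, Heegner hypothesis for `N`,
`L(E^{(d_K)}, 1) ≠ 0`, `ι(P)` the Heegner point of `Dt`, `P` of infinite order) and STEP L at THIS datum
(`IndexLowerBoundLeAt W p K P (v_p Dt.c)`): `MissingLowerBoundAt W p`.  Proof = the route's leaf chain read at the
datum: a globally minimal model `Wd` of the twist `E^{(d_K)}` (analytic rank `0`, same cells), `JointLowerManin`
(item 19180, proved) and `PartnerUpperRankZero` (item 19181, proved).  CONDITIONAL on `PrintedFacts`; closes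
nothing by name.  [cite: GrossZagier1986, Thm. I.(6.3)] [cite: JetchevSkinnerWan2017, §7.4.1 (arXiv:1512.06894 p. 30)] -/
theorem missingLowerBoundAt_of_printedFacts_of_indexLowerBoundLeAt (hF : PrintedFacts)
    (W : WeierstrassCurve ℚ) [W.IsElliptic] [W.IsGloballyMinimal] (p : ℕ) [Fact p.Prime]
    (hr : W.analyticRank = 1) (hp2 : p ≠ 2) (hX : ClassX3 W p) (hS : Additive.SubSemistableTwist W p)
    -- a Heegner datum of the door at `(W, p)`
    (N : ℕ) [NeZero N] (K : Type) [Field K] [NumberField K]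
    (Dt : ModularParametrizationData W N) (H : HeegnerDatum N (NumberField.discr K)) (ι : K →+* ℂ)
    (P : (W.baseChange K).toAffine.Point)
    (hN : W.conductorNorm ℤ = N) (hK : IsImaginaryQuadratic K) (hodd : Odd (NumberField.discr K))
    (hunit : ¬ p ∣ Units.torsionOrder K) (hHe : SatisfiesHeegnerHypothesis N K)
    (hLt : (W.quadraticTwist (NumberField.discr K : ℚ)).entireLFunction 1 ≠ 0)
    (hP : WeierstrassCurve.Affine.Point.map ι.toRatAlgHom P = heegnerPointComplex Dt H)
    (hnt : ¬ IsOfFinAddOrder P)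
    -- STEP L at this datum
    (hidx : IndexLowerBoundLeAt W p K P (padicValNat p Dt.c.natAbs)) :
    MissingLowerBoundAt W p := by
  obtain ⟨hGZ, hKo, hGZK, hmod, hmodD, hCas, hGZ73, -, -, -, hDel, hW16, hWu⟩ := hF
  have hJ : JointLowerManin := schneiderFreeAdditiveX3_jointLowerManin_proof
  have hU : PartnerUpperRankZero := schneiderFreeAdditiveX3_partnerUpperRankZero_proof
  -- a globally minimal model of the twist `E^{d_K}`, of analytic rank zero, on the same cells
  subst hN
  have hD0 : (NumberField.discr K : ℚ) ≠ 0 := by exact_mod_cast NumberField.discr_ne_zero K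
  haveI hEt : (W.quadraticTwist (NumberField.discr K : ℚ)).IsElliptic :=
    W.isElliptic_quadraticTwist hD0
  obtain ⟨Cd, hCd⟩ := hasGlobalMinimalModel_rat_holds (W.quadraticTwist (NumberField.discr K : ℚ))
  set Wd : WeierstrassCurve ℚ := Cd • W.quadraticTwist (NumberField.discr K : ℚ) with hWd_def
  haveI : Wd.IsGloballyMinimal := hCd
  have hWd : Cd • W.quadraticTwist (NumberField.discr K : ℚ) = Wd := rfl
  have hrt : (W.quadraticTwist (NumberField.discr K : ℚ)).analyticRank = 0 :=
    ((W.quadraticTwist _).analyticRank_eq_zero_iff_holds (hmod _)).2 hLt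
  have hrd : Wd.analyticRank = 0 := by rw [← hWd, analyticRank_smul, hrt]
  have hXd : ClassX3 Wd p := SchneiderFree.classX3_twist_of_heegner p W K hK hHe hX Cd hWd
  have hSd : Additive.SubSemistableTwist Wd p :=
    SchneiderFree.subSemistableTwist_twist_of_heegner p W hp2 K hK hodd hHe hX.2 Cd hWd hS
  -- Gross–Zagier bookkeeping (item `JointLowerManin`) and the partner's upper half (item `PartnerUpperRankZero`)
  have hJ' : JointLowerBoundAt W Wd p :=
    hJ hGZ hKo hGZK hmod hmodD hCas hGZ73 W p (W.conductorNorm ℤ) K Dt H ι P Wd hr rfl hK hodd hunit hHe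
      hLt hP hnt ⟨Cd, hWd⟩ hrd hp2 hidx
  exact missingLowerBoundAt_of_joint_of_upper hJ' (hU hDel hGZK hmod hmodD hW16 hWu Wd p hrd hp2 hXd hSd)

/-- **The leaf's body at a pair of the door from `PrintedFacts` and ONE datum in the INDEX-TRIVIAL REGIME** — the
per-pair certificate form.  Same binders as `missingLowerBoundAt_of_printedFacts_of_indexLowerBoundLeAt`, with STEP L
replaced by the arithmetic inequality (IDX) `ord_p [E(K):ℤP] ≤ ord_p ∏_ℓ c_ℓ(E) + v_p(Dt.c)`: NO main conjecture,
NO control, NO duality, NO Kriz–Li theorem, NO preprint.  CONDITIONAL on `PrintedFacts`; the existence of such a datum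
at a given pair is a computation (census «idxcert» of this generation), not asserted.
[cite: GrossZagier1986, Thm. I.(6.3)] [cite: Miller2011LMS, Def. 1.1 and Thm. 4.1] -/
theorem missingLowerBoundAt_of_printedFacts_of_indexLe (hF : PrintedFacts)
    (W : WeierstrassCurve ℚ) [W.IsElliptic] [W.IsGloballyMinimal] (p : ℕ) [Fact p.Prime]
    (hr : W.analyticRank = 1) (hp2 : p ≠ 2) (hX : ClassX3 W p) (hS : Additive.SubSemistableTwist W p)
    (N : ℕ) [NeZero N] (K : Type) [Field K] [NumberField K]
    (Dt : ModularParametrizationData W N) (H : HeegnerDatum N (NumberField.discr K)) (ι : K →+* ℂ)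
    (P : (W.baseChange K).toAffine.Point)
    (hN : W.conductorNorm ℤ = N) (hK : IsImaginaryQuadratic K) (hodd : Odd (NumberField.discr K))
    (hunit : ¬ p ∣ Units.torsionOrder K) (hHe : SatisfiesHeegnerHypothesis N K)
    (hLt : (W.quadraticTwist (NumberField.discr K : ℚ)).entireLFunction 1 ≠ 0)
    (hP : WeierstrassCurve.Affine.Point.map ι.toRatAlgHom P = heegnerPointComplex Dt H)
    (hnt : ¬ IsOfFinAddOrder P)
    -- (IDX): the index within the Tamagawa + Manin slack
    (hidx : padicValNat p (AddSubgroup.zmultiples P).index ≤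
      padicValNat p W.tamagawaProduct + padicValNat p Dt.c.natAbs) :
    MissingLowerBoundAt W p :=
  missingLowerBoundAt_of_printedFacts_of_indexLowerBoundLeAt hF W p hr hp2 hX hS N K Dt H ι P hN hK hodd hunit
    hHe hLt hP hnt (indexLowerBoundLeAt_of_padicValNat_index_le P hidx)

/-! ### §2 One certificate per isogeny class -/

/-- **The leaf's body at EVERY member of the class from a certificate at ONE member.**  For `W ∼ W′` globally minimal
and `ℚ`-isogenous, a door datum AT `W` in the index-trivial regime (IDX) gives `MissingLowerBoundAt W′ p`: Cassels'
isogeny invariance of the BSD quotient (`PrintedFacts`' conjunct `bsdRHS_eq_of_isIsogenous`), the invariance of the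
`L`-function along isogenies (tree) and GZK finiteness make `ord_p #Ш_an − ord_p #Ш` a class invariant (b2b's
`TwistComparison.missingLowerBoundAt_of_isIsogenous`).  CONDITIONAL on `PrintedFacts`.
[cite: MilneADT2006, Thm. I.7.3] [cite: Miller2011LMS, §1 and Def. 1.1] -/
theorem missingLowerBoundAt_of_printedFacts_of_indexLe_of_isIsogenous (hF : PrintedFacts)
    (W : WeierstrassCurve ℚ) [W.IsElliptic] [W.IsGloballyMinimal] (p : ℕ) [Fact p.Prime]
    (hr : W.analyticRank = 1) (hp2 : p ≠ 2) (hX : ClassX3 W p) (hS : Additive.SubSemistableTwist W p)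
    (N : ℕ) [NeZero N] (K : Type) [Field K] [NumberField K]
    (Dt : ModularParametrizationData W N) (H : HeegnerDatum N (NumberField.discr K)) (ι : K →+* ℂ)
    (P : (W.baseChange K).toAffine.Point)
    (hN : W.conductorNorm ℤ = N) (hK : IsImaginaryQuadratic K) (hodd : Odd (NumberField.discr K))
    (hunit : ¬ p ∣ Units.torsionOrder K) (hHe : SatisfiesHeegnerHypothesis N K)
    (hLt : (W.quadraticTwist (NumberField.discr K : ℚ)).entireLFunction 1 ≠ 0)
    (hP : WeierstrassCurve.Affine.Point.map ι.toRatAlgHom P = heegnerPointComplex Dt H)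
    (hnt : ¬ IsOfFinAddOrder P)
    (hidx : padicValNat p (AddSubgroup.zmultiples P).index ≤
      padicValNat p W.tamagawaProduct + padicValNat p Dt.c.natAbs)
    (W' : WeierstrassCurve ℚ) [W'.IsElliptic] [W'.IsGloballyMinimal] (hiso : IsIsogenous W W') :
    MissingLowerBoundAt W' p := by
  have hCas : bsdRHS_eq_of_isIsogenous := hF.2.2.2.2.2.1
  have hGZK : rank_eq_analyticRank_of_analyticRank_le_one := hF.2.2.1
  have hmod : hasEntireLFunction_rat := hF.2.2.2.1
  exact Additive.TwistComparison.missingLowerBoundAt_of_isIsogenous W W' p hCas hGZK hmod hiso (by rw [hr])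
    (missingLowerBoundAt_of_printedFacts_of_indexLe hF W p hr hp2 hX hS N K Dt H ι P hN hK hodd hunit hHe hLt hP
      hnt hidx)

/-! ### §3 The locus form -/

/-- **The rung leaf ON THE INDEX-TRIVIAL LOCUS OF THE DOOR, class level.**  From `PrintedFacts` alone: every pair
`(W, p)` of the door's cells (`r_an = 1`, `p ≠ 2`, `ClassX3`, semistable twist) whose ISOGENY CLASS carries, at some
globally minimal member `W₀ ∼ W`, a Heegner datum of the door with (IDX) satisfies the leaf's body
`MissingLowerBoundAt W p` — the branch cruxes r2 `PotMultBranchIMC` / r3 `GordTwoBranchIMC` are NOT used.  Compare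
`…ControlLeMinimal.additiveX3RankOneLower_of_printedFacts_of_pt_of_branchIMCs` (all pairs, from r2 ∧ r3) and
`…LeafOnKrizLiLocus.additiveX3RankOneLower_onKrizLiLocus_of_printedFacts_of_pt_of_thm120` (the Kriz–Li locus, from
Kriz–Li 2019 Thm. 1.20).  The gap to the leaf is the EXISTENCE of such a datum at every pair — false in general (it
fails where `p` divides the Heegner index beyond the Tamagawa slack, i.e. where the lower half has content).
CONDITIONAL on `PrintedFacts`; closes nothing by name.  [cite: GrossZagier1986, Thm. I.(6.3)]
[cite: JetchevSkinnerWan2017, §7.4.1 (arXiv:1512.06894 p. 30)] -/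
theorem additiveX3RankOneLower_onIndexLocus_of_printedFacts (hF : PrintedFacts) :
    ∀ (W : WeierstrassCurve ℚ) [W.IsElliptic] [W.IsGloballyMinimal] (p : ℕ) [Fact p.Prime],
      W.analyticRank = 1 → p ≠ 2 → ClassX3 W p → Additive.SubSemistableTwist W p →
      (∃ (W₀ : WeierstrassCurve ℚ) (_ : W₀.IsElliptic) (_ : W₀.IsGloballyMinimal),
        IsIsogenous W₀ W ∧ W₀.analyticRank = 1 ∧ ClassX3 W₀ p ∧ Additive.SubSemistableTwist W₀ p ∧
        ∃ (N : ℕ) (_ : NeZero N) (K : Type) (_ : Field K) (_ : NumberField K)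
          (Dt : ModularParametrizationData W₀ N) (H : HeegnerDatum N (NumberField.discr K)) (ι : K →+* ℂ)
          (P : (W₀.baseChange K).toAffine.Point),
          W₀.conductorNorm ℤ = N ∧ IsImaginaryQuadratic K ∧ Odd (NumberField.discr K) ∧
          ¬ p ∣ Units.torsionOrder K ∧ SatisfiesHeegnerHypothesis N K ∧
          (W₀.quadraticTwist (NumberField.discr K : ℚ)).entireLFunction 1 ≠ 0 ∧
          WeierstrassCurve.Affine.Point.map ι.toRatAlgHom P = heegnerPointComplex Dt H ∧
          ¬ IsOfFinAddOrder P ∧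
          padicValNat p (AddSubgroup.zmultiples P).index ≤
            padicValNat p W₀.tamagawaProduct + padicValNat p Dt.c.natAbs) →
      MissingLowerBoundAt W p := by
  intro W _ _ p _ _ hp2 _ _ hdat
  obtain ⟨W₀, _, _, hiso, hr₀, hX₀, hS₀, N, _, K, _, _, Dt, H, ι, P, hN, hK, hodd, hunit, hHe, hLt, hP, hnt,
    hidx⟩ := hdat
  exact missingLowerBoundAt_of_printedFacts_of_indexLe_of_isIsogenous hF W₀ p hr₀ hp2 hX₀ hS₀ N K Dt H ι P hN hK
    hodd hunit hHe hLt hP hnt hidx W hiso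

end Summit.BirchSwinnertonDyer.BirchSwinnertonDyer.Theorems.SchneiderFreeAdditiveX3.LeafIndexRegime

end
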